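import Summits.BirchSwinnertonDyer.Rank1Residual.X11b.LocalTorsionMultiplicative
import Summits.BirchSwinnertonDyer.Rank1Residual.X11b.CastellaErratum
import HarnessLib

/-!
# Route R1's loci from their prime witnesses alone when `p` is non-split or `p ∤ v_p(Δ_min)` (the local-torsion clause of `ErratumHypotheses` / `ChainLocus` discharged)

HONEST FRAMING (cell `b2b-bsdres`, run/shared/lean/b2b/bsd-rank1-residual/, verbatim in every
file): the goal of the cell is to DELETE the COMBINATION-SHAPED residual classes of the
Birch–Swinnerton-Dyer formula for ALL analytic-rank `≤ 1` elliptic curves over `ℚ` — "full BSD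
formula for every rank `≤ 1` curve in class `C`" assembled STRICTLY from published theorems — so
that the rank-`≤ 1` remainder becomes exactly the CONSTRUCTION-SHAPED classes, which are TYPED
(missing-input `Prop`s), NOT attempted. This is not "finishing BSD". Sub-cell
`b2b-bsdres-multr1-p1` (X11b, route R1); no claim beyond the stated class; X11b stays
CONSTRUCTION-SHAPED; nothing here changes a label; no named fact (theorems only; no `sorry`).

Bookkeeping corollaries of `LocalTorsionMultiplicative.lean` (`E(ℚ_p)[p] = 0` at a multiplicative
`p ≥ 3` that is non-split or has `p ∤ v_p(Δ_min)`) in route R1's own vocabulary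
(`CastellaErratum.lean`): the predicates `ErratumHypotheses W p` (the hypotheses of the erratum's
Thm. A′: `5 ≤ p`, `Mult`, `Irr`, `X11.AprimeLocusAt`) and `ChainLocus W p` (A′ + a second ramified
multiplicative prime, `X11.AprimeRam2LocusAt`) both carry the clause "`∀ P ∈ E(ℚ_p), p • P = O → P = O`".
Here they are obtained from the PRIME WITNESSES alone — `q ≠ p` non-split multiplicative with
`p ∤ v_q(Δ_min)` (and `ℓ ∉ {p, q}` multiplicative with `p ∤ v_ℓ(Δ_min)` for `ChainLocus`) — whenever
the reduction at `p` is non-split or `p ∤ v_p(Δ_min)`: `erratumHypotheses_of_witness`,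
`chainLocus_of_witnesses`. On the census (`census500k/`, 1 357 341 `ChainLocus` pairs below `5·10⁵`)
this is the situation of `99.2 %` of the pairs; the remaining split pairs with `p ∣ v_p(Δ_min)` keep
the Tate-period clause (Castella's erratum, Remark after Thm. A′: "[SZ14, Thm. 1.1 (b)]").

References: [Castella2018Erratum] Thm. 1.1 (iv), Thm. A′ (2) and Remark; [SilvermanAEC2009]
VII.2.1, VII.3.1, VII.6.1.
-/

noncomputable section

open scoped Classical

namespace Summit.BirchSwinnertonDyer.Rank1Residual.X11b

open WeierstrassCurve Literature.NumberTheory.EllipticCurves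
  Literature.NumberTheory.EllipticCurves.Rank1Residual
  Literature.NumberTheory.EllipticCurves.Rank1Residual.Typed

variable (W : WeierstrassCurve ℚ) [W.IsElliptic] [W.IsGloballyMinimal] (p : ℕ) [Fact p.Prime]

/-- **`ErratumHypotheses` from the `q`-witness alone** when `p` is non-split or `p ∤ v_p(Δ_min)`:
`5 ≤ p`, `Mult W p`, `Irr W p`, a prime `q ≠ p` of non-split multiplicative reduction with
`p ∤ v_q(Δ_min)` — the clause `E(ℚ_p)[p] = 0` of Thm. A′ is `LocalTorsion.localTorsion_eq_zero_of_mult`.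
[cite: Castella2018Erratum, Thm. A′ (p. 1), hypotheses, and Remark (p. 2)] -/
theorem erratumHypotheses_of_witness (hp : 5 ≤ p) (hmult : Mult W p) (hirr : Irr W p)
    (hloc : ¬ W.HasSplitMultiplicativeReductionAtPrime p ∨ ¬ p ∣ padicValInt p W.minimalDiscriminantInt)
    {q : ℕ} [Fact q.Prime] (hqp : q ≠ p) (hmq : Mult W q)
    (hnsq : ¬ W.HasSplitMultiplicativeReductionAtPrime q)
    (hvq : ¬ p ∣ padicValInt q W.minimalDiscriminantInt) : ErratumHypotheses W p :=
  ⟨hp, hmult, hirr, ⟨q, ‹_›, hqp, hmq, hnsq, hvq⟩,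
    fun P hP => LocalTorsion.localTorsion_eq_zero_of_mult W p (by omega) hmult hloc P hP⟩

/-- **`ChainLocus` from its two prime witnesses alone** when `p` is non-split or `p ∤ v_p(Δ_min)`:
`5 ≤ p`, `Mult W p`, `Irr W p`, `q ≠ p` non-split multiplicative with `p ∤ v_q(Δ_min)`, and
`ℓ ∉ {p, q}` multiplicative with `p ∤ v_ℓ(Δ_min)`. (On `99.2 %` of the `ChainLocus` census the
reduction at `p` is non-split or has `p ∤ v_p(Δ_min)`.)
[cite: Castella2018Erratum, Thm. A′ (p. 1), hypotheses, and Remark (p. 2)] [cite: Castella2018, §5 (arXiv:1704.06608 p. 12)] -/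
theorem chainLocus_of_witnesses (hp : 5 ≤ p) (hmult : Mult W p) (hirr : Irr W p)
    (hloc : ¬ W.HasSplitMultiplicativeReductionAtPrime p ∨ ¬ p ∣ padicValInt p W.minimalDiscriminantInt)
    {q : ℕ} [Fact q.Prime] {ℓ : ℕ} [Fact ℓ.Prime] (hqp : q ≠ p) (hℓp : ℓ ≠ p) (hℓq : ℓ ≠ q)
    (hmq : Mult W q) (hnsq : ¬ W.HasSplitMultiplicativeReductionAtPrime q)
    (hvq : ¬ p ∣ padicValInt q W.minimalDiscriminantInt)
    (hmℓ : Mult W ℓ) (hvℓ : ¬ p ∣ padicValInt ℓ W.minimalDiscriminantInt) : ChainLocus W p :=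
  ⟨hp, hmult, hirr, ⟨q, ‹_›, ℓ, ‹_›, hqp, hℓp, hℓq, hmq, hnsq, hvq, hmℓ, hvℓ⟩,
    fun P hP => LocalTorsion.localTorsion_eq_zero_of_mult W p (by omega) hmult hloc P hP⟩

/-- **The local-torsion clause is redundant on the non-split part of the locus**: for `5 ≤ p` with
`Mult`, `Irr` and `p` NON-SPLIT, `ChainLocus W p` is equivalent to the existence of the two prime
witnesses. [cite: Castella2018Erratum, Thm. A′ (p. 1) and Remark (p. 2)] -/
theorem chainLocus_iff_witnesses_of_nonsplit (hp : 5 ≤ p) (hmult : Mult W p) (hirr : Irr W p)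
    (hns : ¬ W.HasSplitMultiplicativeReductionAtPrime p) :
    ChainLocus W p ↔
      ∃ (q : ℕ) (_ : Fact q.Prime) (ℓ : ℕ) (_ : Fact ℓ.Prime), q ≠ p ∧ ℓ ≠ p ∧ ℓ ≠ q ∧
        Mult W q ∧ ¬ W.HasSplitMultiplicativeReductionAtPrime q ∧
        ¬ p ∣ padicValInt q W.minimalDiscriminantInt ∧
        Mult W ℓ ∧ ¬ p ∣ padicValInt ℓ W.minimalDiscriminantInt := by
  refine ⟨fun h => h.2.2.2.1, fun ⟨q, hq, ℓ, hℓ, hqp, hℓp, hℓq, hmq, hnsq, hvq, hmℓ, hvℓ⟩ => ?_⟩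
  haveI := hq
  haveI := hℓ
  exact chainLocus_of_witnesses W p hp hmult hirr (Or.inl hns) hqp hℓp hℓq hmq hnsq hvq hmℓ hvℓ

/-- The same on the part `p ∤ v_p(Δ_min)` (split or not). [cite: Castella2018Erratum, Thm. A′ (p. 1) and Remark (p. 2)] -/
theorem chainLocus_iff_witnesses_of_not_dvd (hp : 5 ≤ p) (hmult : Mult W p) (hirr : Irr W p)
    (hv : ¬ p ∣ padicValInt p W.minimalDiscriminantInt) :
    ChainLocus W p ↔
      ∃ (q : ℕ) (_ : Fact q.Prime) (ℓ : ℕ) (_ : Fact ℓ.Prime), q ≠ p ∧ ℓ ≠ p ∧ ℓ ≠ q ∧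
        Mult W q ∧ ¬ W.HasSplitMultiplicativeReductionAtPrime q ∧
        ¬ p ∣ padicValInt q W.minimalDiscriminantInt ∧
        Mult W ℓ ∧ ¬ p ∣ padicValInt ℓ W.minimalDiscriminantInt := by
  refine ⟨fun h => h.2.2.2.1, fun ⟨q, hq, ℓ, hℓ, hqp, hℓp, hℓq, hmq, hnsq, hvq, hmℓ, hvℓ⟩ => ?_⟩
  haveI := hq
  haveI := hℓ
  exact chainLocus_of_witnesses W p hp hmult hirr (Or.inr hv) hqp hℓp hℓq hmq hnsq hvq hmℓ hvℓ

end Summit.BirchSwinnertonDyer.Rank1Residual.X11b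

end
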